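import Mathlib
import Summits.Ventures.FusionMHD.Models.CerfonFreidbergIterLikeShapeCert
import Summits.Ventures.FusionMHD.Models.CerfonFreidbergIterLikePlasmaSection
import HarnessLib

/-!
# Ventures/FusionMHD — Models/CerfonFreidbergIterLikeShapeFidelity.lean: HOW D-SHAPED IS THE CERFON–FREIDBERG
# ITER-LIKE MODEL PLASMA? For every real `τ`: `−8.7·10⁻⁷ ≤ U ≤ 5.4·10⁻⁷` along Freidberg's printed reference surface
# (6.154) (and `U` takes both signs there), i.e. the printed D-shape IS the flux surface `ψ_N = 1` of the model to
# `|ψ_N − 1| ≤ 2.5·10⁻⁵`, and the model separatrix and the D-shape differ by `|Y² − Y⋆²| ≤ 4.35·10⁻⁵` along every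
# vertical line of the box — a kernel MODEL-VALIDITY certificate of the Cerfon–Freidberg boundary fit

HONEST FRAMING (LADDER-GRIDFUSION three columns; CF rung; companion of S2 #34 «F1.CF-AXIS-ITER» and of every row that uses
THE Cerfon–Freidberg ITER-like instance of record `U` — `Models/CerfonFreidbergIterLikeAxisCert.lean`).  The Cerfon–Freidberg
construction fits seven point / slope / curvature conditions (6.155) on the printed D-shaped reference surface
`X = 1 + ε cos(τ + δ₀ sin τ)`, `Y = εκ sin τ` (Freidberg 2014 (6.154); `(ε, κ, δ) = (8/25, 17/10, 33/100)`, `δ₀ = arcsin δ`);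
the model plasma boundary is the zero set `{U = 0}` (in the bounding box ONE up–down-symmetric lens `|Y| < Y⋆(X)`,
`Models/…PlasmaSection.lean`).  How far is that lens from the printed D-shape?  Cerfon–Freidberg 2010 / Freidberg 2014 §6.6.1
answer with a figure; this file answers with kernel theorems about THE flux of record, on top of the Taylor-model range
certificate of `Models/CerfonFreidbergIterLikeShapeCert.lean` (`refProg_bounds_Icc` on `[0, 3217/1024] ⊃ [0, π]`):

* §4 evenness in `τ` (mirror image of the curve, `U(X, −Y) = U(X, Y)` — `U_neg`) and `2π`-periodicity reduce every real `τ`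
  to `[0, π]`: **`U_referenceSurface_bounds`: `−87/10⁸ ≤ U(X(τ), Y(τ)) ≤ 54/10⁸` for every `τ`** (`|U| < 10⁻⁶`,
  `abs_U_referenceSurface_lt`); TIGHTNESS: `U ≤ −66/10⁸` at `τ = 217/256` (that reference point lies INSIDE the model plasma)
  and `U ≥ 46/10⁸` at `τ = 145/64` (OUTSIDE) — the printed curve weaves across the model separatrix
  (`U_referenceSurface_inside` / `_outside`);
* §5 in normalised flux `ψ_N := 1 − U/U_axis` (`0` on the magnetic axis, `1` on the model boundary; `U_axis ≤ −0.03684604` by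
  #34): **`abs_psiN_referenceSurface_sub_one_le`: `|ψ_N − 1| ≤ 1/40000` on the whole printed D-shape**; and geometrically,
  with `Y⋆(X)` the half-height of the model plasma (`Ystar`, `Ystar_spec`) and `U_Y = 2Y·H`, `H ≥ 1/50`
  (`CriticalPoint.vertSlope_lb`) turned into the mean-value inequality `vertProfile_sub_ge`:
  **`sq_sub_Ystar_sq_le`: `|Y(τ)² − Y⋆(X(τ))²| ≤ 87/(2·10⁶)`** for every `τ` whose abscissa lies on the open midplane chord
  (at the chord ends both curves close on the midplane) — e.g. wherever the D-shape has `|Y| ≥ 1/4` the two boundaries are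
  `≤ 1.8·10⁻⁴` apart vertically (minor half-width `ε = 0.32`, half-height `κε = 0.544`).

CERTIFIED (kernel): exactly the statements above, for THE model flux.  VALIDATED (never used): the Arb / float numbers quoted in
the companion file (max |U| ≈ 7.16·10⁻⁷).  MODELLED: analytic Cerfon–Freidberg family (ideal MHD, Solov'ev profiles `A = 0`,
fixed analytic boundary) fitted to the printed ITER-like triple; these theorems quantify the MODEL'S fidelity to the printed
SHAPE — they say nothing about any device and nothing about stability.  Typer/prover: gridfusion-model-5 (g6), 2026-08-27.
Citations: Freidberg 2014 §6.6.1 (6.153)–(6.156) [Freidberg2014]; Cerfon–Freidberg 2010 [CerfonFreidberg2010];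
Pataki–Cerfon–Freidberg 2013 §6.1 [PatakiCerfonFreidberg2013].
-/

noncomputable section

open Set
open Literature.Analysis.ValidatedNumerics Literature.Analysis.ValidatedNumerics.PolyMP
open Literature.MathematicalPhysics.MHD Literature.MathematicalPhysics.MHD.CerfonFreidberg _root_.Real

namespace Summit.Ventures.FusionMHD.Models.CFIterLike

/-! ## §4 Evenness and periodicity in `τ`; the bound on the whole reference curve -/

/-- The reference curve at `−τ` is the mirror image of the curve at `τ`, and `U` is even in `Y`. -/
theorem refU_neg (τ : ℝ) : refU (-τ) = refU τ := by
  unfold refU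
  rw [referenceSurface_fst, referenceSurface_snd, referenceSurface_fst, referenceSurface_snd]
  have e1 : -τ + δ₀ * Real.sin (-τ) = -(τ + δ₀ * Real.sin τ) := by rw [Real.sin_neg]; ring
  rw [e1, Real.cos_neg, Real.sin_neg, mul_neg, U_neg]

/-- `2π`-periodicity (integer multiples). -/
theorem refU_add_int_mul (τ : ℝ) (n : ℤ) : refU (τ + n * (2 * π)) = refU τ := by
  unfold refU
  rw [referenceSurface_fst, referenceSurface_snd, referenceSurface_fst, referenceSurface_snd,
    Real.sin_add_int_mul_two_pi]
  have e : τ + n * (2 * π) + δ₀ * Real.sin τ = (τ + δ₀ * Real.sin τ) + n * (2 * π) := by ring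
  rw [e, Real.cos_add_int_mul_two_pi]

/-- Reduction of any `τ` to `[0, π]`. -/
theorem exists_reduce (τ : ℝ) : ∃ θ : ℝ, 0 ≤ θ ∧ θ ≤ π ∧ refU τ = refU θ := by
  have hπ := Real.pi_pos
  set n := ⌊(τ + π) / (2 * π)⌋ with hn
  have h1 : (n : ℝ) ≤ (τ + π) / (2 * π) := Int.floor_le _
  have h2 : (τ + π) / (2 * π) < n + 1 := Int.lt_floor_add_one _
  rw [le_div_iff₀ (by positivity)] at h1
  rw [div_lt_iff₀ (by positivity)] at h2
  set θ := τ - n * (2 * π) with hθ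
  have hper : refU τ = refU θ := by
    have e : τ = θ + n * (2 * π) := by rw [hθ]; ring
    conv_lhs => rw [e]
    exact refU_add_int_mul θ n
  by_cases hs : 0 ≤ θ
  · exact ⟨θ, hs, by linarith, hper⟩
  · refine ⟨-θ, by linarith, by linarith, ?_⟩
    rw [hper, refU_neg]

/-- **THE RANGE THEOREM:** for every real `τ`, `−87/10⁸ ≤ U(X(τ), Y(τ)) ≤ 54/10⁸` along the printed reference
surface (6.154) of THE Cerfon–Freidberg ITER-like instance. -/
theorem U_referenceSurface_bounds (τ : ℝ) :
    -(87 : ℝ) / 10 ^ 8 ≤ U (referenceSurface ε κ δ₀ τ).1 (referenceSurface ε κ δ₀ τ).2 ∧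
      U (referenceSurface ε κ δ₀ τ).1 (referenceSurface ε κ δ₀ τ).2 ≤ 54 / 10 ^ 8 := by
  obtain ⟨θ, h0, h1, heq⟩ := exists_reduce τ
  have hπ : θ ≤ ((piBar : ℚ) : ℝ) := h1.trans (by have := Real.pi_lt_d6; norm_num [piBar]; linarith)
  have h := refProg_bounds_Icc h0 hπ
  rw [← refU_eq_toFunP, ← heq] at h
  have e1 : (((uLo : ℚ) : ℚ) : ℝ) = -(87 : ℝ) / 10 ^ 8 := by norm_num [uLo]
  have e2 : (((uHi : ℚ) : ℚ) : ℝ) = (54 : ℝ) / 10 ^ 8 := by norm_num [uHi]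
  rw [e1, e2] at h
  exact h

/-- Corollary: **`|U| < 10⁻⁶` on the whole reference curve.** -/
theorem abs_U_referenceSurface_lt (τ : ℝ) :
    |U (referenceSurface ε κ δ₀ τ).1 (referenceSurface ε κ δ₀ τ).2| < 1 / 10 ^ 6 := by
  obtain ⟨h1, h2⟩ := U_referenceSurface_bounds τ
  rw [abs_lt]; constructor <;> linarith

/-- **Tightness, inside:** at `τ = 217/256` the reference point lies INSIDE the model plasma, `U ≤ −66/10⁸`. -/
theorem U_referenceSurface_inside :
    U (referenceSurface ε κ δ₀ (217 / 256)).1 (referenceSurface ε κ δ₀ (217 / 256)).2 ≤ -(66 : ℝ) / 10 ^ 8 := by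
  have h := pointIn_ok
  simp only [pointIn, Bool.and_eq_true, decide_eq_true_eq] at h
  have hb := le_of_pointModel h.1 h.2 boxMem_params
  have e : refU (217 / 256) = refProg.toFunP params (((217 / 256 : ℚ) : ℚ) : ℝ) := by
    rw [refU_eq_toFunP]; norm_num
  rw [refU] at e
  rw [e]
  refine hb.trans ?_
  norm_num

/-- **Tightness, outside:** at `τ = 145/64` the reference point lies OUTSIDE the model plasma, `U ≥ 46/10⁸`. -/
theorem U_referenceSurface_outside :
    (46 : ℝ) / 10 ^ 8 ≤ U (referenceSurface ε κ δ₀ (145 / 64)).1 (referenceSurface ε κ δ₀ (145 / 64)).2 := by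
  have h := pointOut_ok
  simp only [pointOut, Bool.and_eq_true, decide_eq_true_eq] at h
  have hb := ge_of_pointModel h.1 h.2 boxMem_params
  have e : refU (145 / 64) = refProg.toFunP params (((145 / 64 : ℚ) : ℚ) : ℝ) := by
    rw [refU_eq_toFunP]; norm_num
  rw [refU] at e
  rw [e]
  refine le_trans ?_ hb
  norm_num

/-! ## §5 Corollaries: normalised flux on the printed D-shape; vertical gap to the model separatrix -/

/-- Normalised poloidal flux of the model: `ψ_N = 1 − U/U_axis` (`0` on the magnetic axis, `1` on `{U = 0}`). -/
def psiN (X Y : ℝ) : ℝ := 1 - U X Y / U Xa 0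

/-- **`|ψ_N − 1| ≤ 1/40000 = 2.5·10⁻⁵` on the whole printed reference surface** (the D-shape (6.154) is the flux
surface `ψ_N = 1` of the model to that accuracy). -/
theorem abs_psiN_referenceSurface_sub_one_le (τ : ℝ) :
    |psiN (referenceSurface ε κ δ₀ τ).1 (referenceSurface ε κ δ₀ τ).2 - 1| ≤ 1 / 40000 := by
  obtain ⟨h1, h2⟩ := U_referenceSurface_bounds τ
  obtain ⟨ha1, ha2⟩ := U_axis_bounds
  set u := U (referenceSurface ε κ δ₀ τ).1 (referenceSurface ε κ δ₀ τ).2 with hu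
  have hne : U Xa 0 ≠ 0 := by linarith
  have hneg : U Xa 0 < 0 := by linarith
  rw [psiN, show 1 - u / U Xa 0 - 1 = -(u / U Xa 0) by ring, abs_neg, abs_div, div_le_iff₀ (abs_pos.mpr hne),
    abs_of_neg hneg]
  rw [abs_le]
  constructor <;> nlinarith

/-- The vertical profile `W ↦ G₀ + G₂ W + G₄ W² + G₆ W³` (`U(X, Y)` at `W = Y²`). -/
def vertProfile (X W : ℝ) : ℝ := vertG₀ coeff X + vertG₂ coeff X * W + vertG₄ coeff X * W ^ 2 + vertG₆ coeff X * W ^ 3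

/-- `U(X, Y) = vertProfile X (Y²)`. -/
theorem U_eq_vertProfile (X Y : ℝ) : U X Y = vertProfile X (Y ^ 2) := by
  rw [U_eq_vert, vertProfile]; ring

/-- Derivative of the vertical profile in `W`. -/
theorem hasDerivAt_vertProfile (X W : ℝ) :
    HasDerivAt (vertProfile X) (vertG₂ coeff X + 2 * vertG₄ coeff X * W + 3 * vertG₆ coeff X * W ^ 2) W := by
  unfold vertProfile
  refine HasDerivAt.congr_deriv ?_
    (show 0 + vertG₂ coeff X * 1 + vertG₄ coeff X * (2 * W ^ 1 * 1) + vertG₆ coeff X * (3 * W ^ 2 * 1) = _ by ring)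
  exact (((hasDerivAt_const W (vertG₀ coeff X)).add ((hasDerivAt_id W).const_mul (vertG₂ coeff X))).add
    (((hasDerivAt_id W).pow 2).const_mul (vertG₄ coeff X))).add (((hasDerivAt_id W).pow 3).const_mul (vertG₆ coeff X))

/-- **The vertical slope bound as a Lipschitz-from-below inequality:** for `0 ≤ W₁ ≤ W₂ ≤ 9/25` and `X` on the chord,
`(W₂ − W₁)/50 ≤ vertProfile X W₂ − vertProfile X W₁` (mean value inequality with `H ≥ 1/50`, `vertSlope_lb`). -/
theorem vertProfile_sub_ge {X W₁ W₂ : ℝ} (hX1 : (17 : ℝ) / 25 ≤ X) (hX2 : X ≤ 33 / 25) (h0 : 0 ≤ W₁) (h12 : W₁ ≤ W₂)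
    (h2 : W₂ ≤ 9 / 25) : 1 / 50 * (W₂ - W₁) ≤ vertProfile X W₂ - vertProfile X W₁ := by
  have hD : Convex ℝ (Icc (0 : ℝ) (9 / 25)) := convex_Icc _ _
  have hcont : ContinuousOn (vertProfile X) (Icc (0 : ℝ) (9 / 25)) :=
    fun W _ => (hasDerivAt_vertProfile X W).continuousAt.continuousWithinAt
  have hdiff : DifferentiableOn ℝ (vertProfile X) (interior (Icc (0 : ℝ) (9 / 25))) :=
    fun W _ => (hasDerivAt_vertProfile X W).differentiableAt.differentiableWithinAt
  have hge : ∀ W ∈ interior (Icc (0 : ℝ) (9 / 25)), (1 : ℝ) / 50 ≤ deriv (vertProfile X) W := by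
    intro W hW
    rw [interior_Icc] at hW
    rw [(hasDerivAt_vertProfile X W).deriv]
    have hs : (Real.sqrt W) ^ 2 = W := Real.sq_sqrt hW.1.le
    have h4 : (Real.sqrt W) ^ 4 = W ^ 2 := by rw [show (4 : ℕ) = 2 * 2 from rfl, pow_mul, hs]
    have hb := vertSlope_lb hX1 hX2 (Y := Real.sqrt W) (by rw [hs]; exact hW.2.le)
    rw [hs, h4] at hb
    linarith
  exact hD.mul_sub_le_image_sub_of_le_deriv hcont hdiff hge W₁ ⟨h0, h12.trans h2⟩ W₂ ⟨h0.trans h12, h2⟩ h12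

/-- **THE VERTICAL GAP:** for every `τ` whose reference abscissa `X(τ)` lies on the open chord `(17/25, 33/25)`,
`|Y(τ)² − Y⋆(X(τ))²| ≤ 87/(2·10⁶)`, `Y⋆` the half-height of the model plasma (`Ystar`): the printed D-shape and
the model separatrix differ by at most that much in `Y²` along the vertical through `X(τ)`. -/
theorem sq_sub_Ystar_sq_le (τ : ℝ) (hX : (referenceSurface ε κ δ₀ τ).1 ∈ Ioo (17 / 25 : ℝ) (33 / 25)) :
    |(referenceSurface ε κ δ₀ τ).2 ^ 2 - Ystar (referenceSurface ε κ δ₀ τ).1 ^ 2| ≤ 87 / (2 * 10 ^ 6) := by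
  set X := (referenceSurface ε κ δ₀ τ).1 with hXdef
  set Y := (referenceSurface ε κ δ₀ τ).2 with hYdef
  obtain ⟨⟨hs0, hs1⟩, hzero, -, -⟩ := Ystar_spec hX
  obtain ⟨hb1, hb2⟩ := U_referenceSurface_bounds τ
  rw [← hXdef, ← hYdef] at hb1 hb2
  have hY2 : Y ^ 2 ≤ 9 / 25 := by
    have e : Y = ε * κ * Real.sin τ := by rw [hYdef, referenceSurface_snd]
    have hs := Real.sin_sq_le_one τ
    rw [e]; unfold ε κ; nlinarith
  have hYs2 : Ystar X ^ 2 ≤ 9 / 25 := by nlinarith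
  have hU1 : U X Y = vertProfile X (Y ^ 2) := U_eq_vertProfile X Y
  have hU2 : vertProfile X (Ystar X ^ 2) = 0 := by rw [← U_eq_vertProfile]; exact hzero
  rw [abs_le]
  rcases le_total (Y ^ 2) (Ystar X ^ 2) with hle | hle
  · have h := vertProfile_sub_ge hX.1.le hX.2.le (sq_nonneg Y) hle hYs2
    rw [hU2, ← hU1] at h
    constructor <;> nlinarith
  · have h := vertProfile_sub_ge hX.1.le hX.2.le (sq_nonneg _) hle hY2
    rw [hU2, ← hU1] at h
    constructor <;> nlinarith

end Summit.Ventures.FusionMHD.Models.CFIterLike
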